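import Literature.NumberTheory.GaloisRepresentations.GaloisCohomologyScalarActionDegreeTwoProofs
import Literature.NumberTheory.EllipticCurves.NilpotentEndomorphismExponentOfCardProofs
import HarnessLib

/-!
# From a COUNT `#H²(K, M) ≤ p^c` to the ANNIHILATION `H²(π^c •) = 0`, for a module on which `p = π · a` and `π` is
# nilpotent (theorems only — no definition, no named fact, no instance, no `sorry`)

Topic `NumberTheory/EllipticCurves` (cell `pub/bsd-print-x9`, shared μ-crux, registered stub `stub_h5bAtS`; brick (v) of the
uniform-`ι` road for Howard's H.5(b) at `v ∣ p`: the `H²`-functoriality plumbing turning the numerical local-duality bounds (F4c)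
(`ZpExtensionEisensteinPiLevelH2BoundProofs`: `#H²(K_w, Fil_w(T/π^iT)) ≤ p^{p^s}`, …) into the annihilation hypotheses `hH2Fil` /
`hH2` of `TowerTorsionCutInputsProofs` / `ZpExtensionEisensteinPiTorsionCutInputsProofs`).

For a discrete Galois module `ρ` on `M` and continuous equivariant endomorphisms, the tree's finite-group lemma
`iterate_apply_eq_zero_of_natCard_le_pow` (`#N ≤ p^c`, `p · x = φ(ψ x)`, `φ` nilpotent ⇒ `φ^c = 0`) is applied to
`N := H²(K, M)`, `φ := H²(T)`, `ψ := H²(A)` for endomorphisms `T`, `A` of `M` with `p · x = T (A x)` and `T` nilpotent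
(on Howard's levels: `T = π •`, `A = −π^{m−1} •`, `π^m = −p`):

* §1 degree-`2` functoriality of `galoisCohomology.map` on explicit `2`-cocycles: `galoisCohomology_map_two_congr_apply`,
  `galoisCohomology_map_two_map_two_apply` (composition), `galoisCohomology_map_two_self_apply` (an endomorphism acting as the
  identity), and for a FAMILY `T n` of endomorphisms
  with `T 0 = id`, `T (n+1) = T 1 ∘ T n` pointwise: `galoisCohomology_iterate_map_two_eq` (`H²(T 1)^[n] = H²(T n)`);
* §2 **`galoisCohomology_map_two_eq_zero_of_natCard_le_pow`**: `#H²(K, M) ≤ p^c`, `p · x = T 1 (A x)`, `T 1 ∘ A = A ∘ T 1`,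
  `T n = 0` for some `n` ⇒ `H²(T c) = 0` (and `H²(t) = 0` for every `t` acting as `T c`, `…_of_forall_apply_eq`);
* §3 SCALAR form **`galoisCohomology_scalarMap_two_pow_eq_zero_of_natCard_le_pow`**: `R`-linear `ρ`, `(p : R) = π · a`, `π`
  nilpotent on `M`, `#H²(K, M) ≤ p^c` ⇒ `galoisCohomology.scalarMap ρ hρ 2 (π ^ c) = 0` (the `hH2` letter);
* §4 `exists_subScalarEndo_apply` / `exists_subScalarPowFamily_apply`: the scalar endomorphisms `r •` / `π^n •` of an `R`-stable
  `Γ`-stable `ℤ`-submodule `Fil ≤ M`, as continuous equivariant endomorphisms of the subrepresentation (the `T`, `A` of §2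
  for the plus parts, whose carrier has no `Module R` instance).

References: B. Howard, Compositio Math. 140 (2004), §2.2 and proof of Thm. 2.2.10 (`π^m = −p` in `S_𝔮`), Lemma 3.2.7 (arXiv p. 16
L150–156: `H²(K_v, Fil_v 𝐓)[𝔭]` controls the cokernel); Serre, *Galois Cohomology* (1997), I §2.2–2.3; Washington (1997) §13.2.
No summit statement is proved; BSD is not proved by any of this.
-/

set_option autoImplicit false

noncomputable section

open CategoryTheory Function
open scoped ContRepresentation

universe u v

namespace Literature.NumberTheory.EllipticCurves

open Literature.NumberTheory.GaloisRepresentations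
open Literature.NumberTheory.GaloisRepresentations.DiscreteGaloisModule

variable {K : Type u} [Field K] {M : Type u} [AddCommGroup M] [TopologicalSpace M] [DiscreteTopology M]
  {M' : Type u} [AddCommGroup M'] [TopologicalSpace M'] [DiscreteTopology M']
  {M'' : Type u} [AddCommGroup M''] [TopologicalSpace M''] [DiscreteTopology M'']
  {ρ : DiscreteGaloisModule K M} {ρ' : DiscreteGaloisModule K M'} {ρ'' : DiscreteGaloisModule K M''}

/-! ## §1 Degree-`2` functoriality on explicit cocycles -/

/-- `galoisCohomology.map f 2 [c] = [f ∘ c]` on inhomogeneous `2`-cocycles (tree `cohomologyMap_twoCocycleClass`).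
[cite: SerreGaloisCohomology1997, Ch. I §2.2–2.3] -/
theorem galoisCohomology_map_two_twoCocycleClass [LocallyCompactSpace (Field.absoluteGaloisGroup K)]
    (f : ρ.toContRepresentation →ⁱL ρ'.toContRepresentation) (c : contTwoCocycles ρ.toTopRep) :
    galoisCohomology.map f 2 (twoCocycleClass ρ.toTopRep c) =
      twoCocycleClass ρ'.toTopRep
        (contTwoCocycles.pullback (ContinuousMonoidHom.id (Field.absoluteGaloisGroup K)) (X := ρ.toTopRep) (Y := ρ'.toTopRep)
          (resIdHom (TopRep.ofHom ⟨f.toContinuousLinearMap, f.isIntertwining'⟩ : ρ.toTopRep ⟶ ρ'.toTopRep)) c) :=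
  cohomologyMap_twoCocycleClass _ c

/-- **Two continuous equivariant maps with the same underlying function induce the same map on `H²`.**
[cite: SerreGaloisCohomology1997, Ch. I §2.2] -/
theorem galoisCohomology_map_two_congr_apply (f g : ρ.toContRepresentation →ⁱL ρ'.toContRepresentation)
    (hfg : ∀ x, f x = g x) (z : galoisCohomology ρ 2) : galoisCohomology.map f 2 z = galoisCohomology.map g 2 z := by
  haveI : CompactSpace (Field.absoluteGaloisGroup K) := absoluteGaloisGroup_compactSpace K
  obtain ⟨c, rfl⟩ := twoCocycleClass_surjective ρ.toTopRep z
  rw [galoisCohomology_map_two_twoCocycleClass, galoisCohomology_map_two_twoCocycleClass]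
  congr 1
  exact Subtype.ext (ContinuousMap.ext fun q ↦ by
    obtain ⟨σ, τ⟩ := q
    rw [pullback₂_id_resIdHom_apply, pullback₂_id_resIdHom_apply]
    exact hfg _)

/-- **`H²(g) ∘ H²(f) = H²(h)` whenever `h = g ∘ f` on elements.** [cite: SerreGaloisCohomology1997, Ch. I §2.2] -/
theorem galoisCohomology_map_two_map_two_apply (f : ρ.toContRepresentation →ⁱL ρ'.toContRepresentation)
    (g : ρ'.toContRepresentation →ⁱL ρ''.toContRepresentation) (h : ρ.toContRepresentation →ⁱL ρ''.toContRepresentation)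
    (hcomp : ∀ x, h x = g (f x)) (z : galoisCohomology ρ 2) :
    galoisCohomology.map g 2 (galoisCohomology.map f 2 z) = galoisCohomology.map h 2 z := by
  haveI : CompactSpace (Field.absoluteGaloisGroup K) := absoluteGaloisGroup_compactSpace K
  obtain ⟨c, rfl⟩ := twoCocycleClass_surjective ρ.toTopRep z
  rw [galoisCohomology_map_two_twoCocycleClass, galoisCohomology_map_two_twoCocycleClass,
    galoisCohomology_map_two_twoCocycleClass]
  congr 1
  exact Subtype.ext (ContinuousMap.ext fun q ↦ by
    obtain ⟨σ, τ⟩ := q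
    rw [pullback₂_id_resIdHom_apply, pullback₂_id_resIdHom_apply, pullback₂_id_resIdHom_apply]
    exact (hcomp _).symm)

/-- `H²` of an endomorphism acting as the identity is the identity. [cite: SerreGaloisCohomology1997, Ch. I §2.2] -/
theorem galoisCohomology_map_two_self_apply (f : ρ.toContRepresentation →ⁱL ρ.toContRepresentation) (hf : ∀ x, f x = x)
    (z : galoisCohomology ρ 2) : galoisCohomology.map f 2 z = z := by
  haveI : CompactSpace (Field.absoluteGaloisGroup K) := absoluteGaloisGroup_compactSpace K
  obtain ⟨c, rfl⟩ := twoCocycleClass_surjective ρ.toTopRep z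
  rw [galoisCohomology_map_two_twoCocycleClass]
  congr 1
  exact Subtype.ext (ContinuousMap.ext fun q ↦ by
    obtain ⟨σ, τ⟩ := q
    rw [pullback₂_id_resIdHom_apply]
    exact hf _)

/-- **`H²(T 1)^[n] = H²(T n)`** for a family of endomorphisms `T n` with `T 0 = id` and `T (n+1) = T 1 ∘ T n` on elements
(`T n` «acts as the `n`-th power of `T 1`»). [cite: SerreGaloisCohomology1997, Ch. I §2.2] -/
theorem galoisCohomology_iterate_map_two_eq (T : ℕ → (ρ.toContRepresentation →ⁱL ρ.toContRepresentation))
    (hT0 : ∀ x, T 0 x = x) (hTsucc : ∀ n x, T (n + 1) x = T 1 (T n x)) (n : ℕ) (z : galoisCohomology ρ 2) :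
    (galoisCohomology.map (T 1) 2)^[n] z = galoisCohomology.map (T n) 2 z := by
  induction n generalizing z with
  | zero => rw [iterate_zero_apply, galoisCohomology_map_two_self_apply (T 0) hT0]
  | succ n ih =>
    rw [iterate_succ_apply', ih, galoisCohomology_map_two_map_two_apply (T n) (T 1) (T (n + 1)) (hTsucc n)]

/-! ## §2 Count ⇒ annihilation, endomorphism form -/

/-- **`#H²(K, M) ≤ p^c ⇒ H²(T c) = 0`** for a family `T n` of continuous equivariant endomorphisms of `M` acting as the powers
of `T 1`, an endomorphism `A` commuting with `T 1` and with `p · x = T 1 (A x)` on `M`, and `T n = 0` for some `n` — the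
finite-`p`-group lemma `iterate_apply_eq_zero_of_natCard_le_pow` applied to `φ := H²(T 1)`, `ψ := H²(A)` on `H²(K, M)`.
[cite: Howard2004HeegnerKolyvagin, §2.2, proof of Thm. 2.2.10 and Lemma 3.2.7 (arXiv p. 16 L150–156)] [cite: Washington1997, §13.2] -/
theorem galoisCohomology_map_two_eq_zero_of_natCard_le_pow {p : ℕ} (hp : p.Prime)
    (T : ℕ → (ρ.toContRepresentation →ⁱL ρ.toContRepresentation)) (hT0 : ∀ x, T 0 x = x)
    (hTsucc : ∀ n x, T (n + 1) x = T 1 (T n x))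
    (A : ρ.toContRepresentation →ⁱL ρ.toContRepresentation) (hcomm : ∀ x, T 1 (A x) = A (T 1 x))
    (hpT : ∀ x : M, p • x = T 1 (A x)) (hnil : ∃ n, ∀ x, T n x = 0)
    [Finite (galoisCohomology ρ 2)] {c : ℕ} (hcard : Nat.card (galoisCohomology ρ 2) ≤ p ^ c) (z : galoisCohomology ρ 2) :
    galoisCohomology.map (T c) 2 z = 0 := by
  rw [← galoisCohomology_iterate_map_two_eq T hT0 hTsucc c z]
  refine iterate_apply_eq_zero_of_natCard_le_pow hp c (galoisCohomology.map (T 1) 2) (galoisCohomology.map A 2)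
    (fun y ↦ ?_) (fun y ↦ ?_) ?_ hcard z
  · -- commute on `H²`
    rw [galoisCohomology_map_two_map_two_apply A (T 1) ((T 1).comp A) (fun _ ↦ rfl),
      galoisCohomology_map_two_map_two_apply (T 1) A (A.comp (T 1)) (fun _ ↦ rfl)]
    exact galoisCohomology_map_two_congr_apply _ _ (fun x ↦ hcomm x) y
  · -- `p • y = H²(T 1) (H²(A) y)`: both are `H²` of the endomorphism `x ↦ p • x = T 1 (A x)`
    haveI : CompactSpace (Field.absoluteGaloisGroup K) := absoluteGaloisGroup_compactSpace K
    rw [galoisCohomology_map_two_map_two_apply A (T 1) ((T 1).comp A) (fun _ ↦ rfl)]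
    have h := cohomologyMap_two_eq_nsmul ρ (TopRep.ofHom ⟨((T 1).comp A).toContinuousLinearMap,
      ((T 1).comp A).isIntertwining'⟩) p (fun x ↦ (hpT x).symm) y
    exact h.symm
  · obtain ⟨n, hn⟩ := hnil
    refine ⟨n, fun y ↦ ?_⟩
    rw [galoisCohomology_iterate_map_two_eq T hT0 hTsucc n y]
    haveI : CompactSpace (Field.absoluteGaloisGroup K) := absoluteGaloisGroup_compactSpace K
    obtain ⟨c', rfl⟩ := twoCocycleClass_surjective ρ.toTopRep y
    rw [galoisCohomology_map_two_twoCocycleClass]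
    have hc : contTwoCocycles.pullback (ContinuousMonoidHom.id (Field.absoluteGaloisGroup K)) (X := ρ.toTopRep)
        (Y := ρ.toTopRep) (resIdHom (TopRep.ofHom ⟨(T n).toContinuousLinearMap, (T n).isIntertwining'⟩ :
          ρ.toTopRep ⟶ ρ.toTopRep)) c' = 0 :=
      Subtype.ext (ContinuousMap.ext fun q ↦ by
        obtain ⟨σ, τ⟩ := q
        rw [pullback₂_id_resIdHom_apply]
        exact hn _)
    rw [hc, twoCocycleClass_zero]
    rfl

/-- **… hence `H²(t) = 0` for every endomorphism `t` acting as `T c`** (the `hH2Fil` letter of `TowerTorsionCutInputsProofs`: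
`∀ z, galoisCohomology.map t 2 z = 0`). [cite: Howard2004HeegnerKolyvagin, Lemma 3.2.7 (arXiv p. 16 L150–156)] [cite: Washington1997, §13.2] -/
theorem galoisCohomology_map_two_eq_zero_of_natCard_le_pow_of_forall_apply_eq {p : ℕ} (hp : p.Prime)
    (T : ℕ → (ρ.toContRepresentation →ⁱL ρ.toContRepresentation)) (hT0 : ∀ x, T 0 x = x)
    (hTsucc : ∀ n x, T (n + 1) x = T 1 (T n x))
    (A : ρ.toContRepresentation →ⁱL ρ.toContRepresentation) (hcomm : ∀ x, T 1 (A x) = A (T 1 x))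
    (hpT : ∀ x : M, p • x = T 1 (A x)) (hnil : ∃ n, ∀ x, T n x = 0)
    [Finite (galoisCohomology ρ 2)] {c : ℕ} (hcard : Nat.card (galoisCohomology ρ 2) ≤ p ^ c)
    (t : ρ.toContRepresentation →ⁱL ρ.toContRepresentation) (ht : ∀ x, t x = T c x) (z : galoisCohomology ρ 2) :
    galoisCohomology.map t 2 z = 0 := by
  rw [galoisCohomology_map_two_congr_apply t (T c) ht z]
  exact galoisCohomology_map_two_eq_zero_of_natCard_le_pow hp T hT0 hTsucc A hcomm hpT hnil hcard z

/-! ## §3 Count ⇒ annihilation, scalar form -/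

/-- **`#H²(K, M) ≤ p^c ⇒ H²(π^c •) = 0`** for an `R`-linear discrete Galois module with `(p : R) = π · a` and `π` nilpotent on
`M` (the `hH2` letter `galoisCohomology.scalarMap ρ hρ 2 (π ^ c) z = 0` of `TowerTorsionCutInputsProofs`).
[cite: Howard2004HeegnerKolyvagin, §2.2, proof of Thm. 2.2.10 and Lemma 3.2.7] [cite: Washington1997, §13.2] -/
theorem galoisCohomology_scalarMap_two_pow_eq_zero_of_natCard_le_pow {R : Type v} [CommRing R] [Module R M]
    (hρ : ρ.IsScalarLinear R) {p : ℕ} (hp : p.Prime) (π a : R) (hpa : (p : R) = π * a)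
    (hnil : ∃ n : ℕ, ∀ x : M, π ^ n • x = 0)
    [Finite (galoisCohomology ρ 2)] {c : ℕ} (hcard : Nat.card (galoisCohomology ρ 2) ≤ p ^ c) (z : galoisCohomology ρ 2) :
    galoisCohomology.scalarMap ρ hρ 2 (π ^ c) z = 0 := by
  refine galoisCohomology_map_two_eq_zero_of_natCard_le_pow hp (fun n ↦ scalarIntertwining ρ hρ (π ^ n))
    (fun x ↦ by rw [scalarIntertwining_apply, pow_zero, one_smul])
    (fun n x ↦ by rw [scalarIntertwining_apply, scalarIntertwining_apply, scalarIntertwining_apply, pow_one, smul_smul,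
      ← pow_succ'])
    (scalarIntertwining ρ hρ a)
    (fun x ↦ by rw [scalarIntertwining_apply, scalarIntertwining_apply, scalarIntertwining_apply, scalarIntertwining_apply,
      smul_smul, smul_smul, pow_one, mul_comm])
    (fun x ↦ by rw [scalarIntertwining_apply, scalarIntertwining_apply, pow_one, smul_smul, ← hpa, Nat.cast_smul_eq_nsmul])
    ?_ hcard z
  obtain ⟨n, hn⟩ := hnil
  exact ⟨n, fun x ↦ by rw [scalarIntertwining_apply]; exact hn x⟩

/-! ## §4 Scalar endomorphisms of an `R`-stable plus part, as endomorphisms of the subrepresentation -/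

/-- **The scalar `r •` restricted to an `R`-stable `Γ_K`-stable `ℤ`-submodule `Fil ≤ M`**, as a continuous equivariant
endomorphism of the subrepresentation (whose carrier `↥Fil` carries no `Module R` instance).
[cite: Howard2004HeegnerKolyvagin, Def. 1.1.1 and §3.1 (arXiv p. 5 L20–21, p. 15: local conditions are R-submodules)] -/
theorem exists_subScalarEndo_apply {R : Type v} [CommRing R] [Module R M] (hρ : ρ.IsScalarLinear R)
    (Fil : Submodule ℤ M) (hΓ : ∀ σ : Field.absoluteGaloisGroup K, Fil ≤ Fil.comap (ρ σ))
    (hFilR : ∀ (r : R) (x : M), x ∈ Fil → r • x ∈ Fil) (r : R) :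
    ∃ t : (ρ.subrepresentation Fil hΓ).toContRepresentation →ⁱL (ρ.subrepresentation Fil hΓ).toContRepresentation,
      ∀ x : Fil, ((t x : Fil) : M) = r • (x : M) :=
  ⟨{ toContinuousLinearMap :=
        ⟨((scalarIntertwining ρ hρ r).toContinuousLinearMap.toLinearMap.restrict fun w hw ↦ hFilR r w hw),
          continuous_of_discreteTopology⟩,
      isIntertwining' := fun σ ↦ ContinuousLinearMap.ext fun x ↦
        Subtype.ext ((scalarIntertwining ρ hρ r).isIntertwining σ (x : M)) },
    fun _ ↦ rfl⟩

/-- **The family `π^n •` on an `R`-stable plus part**, as continuous equivariant endomorphisms `T n` of the subrepresentation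
with `((T n x) : M) = π^n • x` — so `T 0 = id`, `T (n+1) = T 1 ∘ T n` pointwise (the `T` of
`galoisCohomology_map_two_eq_zero_of_natCard_le_pow`). [cite: Howard2004HeegnerKolyvagin, Def. 1.1.1 and §3.1 (arXiv p. 5 L20–21, p. 15)] -/
theorem exists_subScalarPowFamily_apply {R : Type v} [CommRing R] [Module R M] (hρ : ρ.IsScalarLinear R)
    (Fil : Submodule ℤ M) (hΓ : ∀ σ : Field.absoluteGaloisGroup K, Fil ≤ Fil.comap (ρ σ))
    (hFilR : ∀ (r : R) (x : M), x ∈ Fil → r • x ∈ Fil) (π : R) :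
    ∃ T : ℕ → ((ρ.subrepresentation Fil hΓ).toContRepresentation →ⁱL (ρ.subrepresentation Fil hΓ).toContRepresentation),
      ∀ (n : ℕ) (x : Fil), ((T n x : Fil) : M) = π ^ n • (x : M) :=
  ⟨fun n ↦
    { toContinuousLinearMap :=
        ⟨((scalarIntertwining ρ hρ (π ^ n)).toContinuousLinearMap.toLinearMap.restrict fun w hw ↦ hFilR (π ^ n) w hw),
          continuous_of_discreteTopology⟩,
      isIntertwining' := fun σ ↦ ContinuousLinearMap.ext fun x ↦
        Subtype.ext ((scalarIntertwining ρ hρ (π ^ n)).isIntertwining σ (x : M)) },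
    fun _ _ ↦ rfl⟩

end Literature.NumberTheory.EllipticCurves

end
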